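import Literature.AlgebraicGeometry.HodgeTheory.WeilClassesFieldCommutativeDivisorAlgebra
import Literature.AlgebraicGeometry.HodgeTheory.WeilClassesFieldIsogenyTransportOfStructure
import HarnessLib

/-!
# Criterion (2) with commutative `End` and the CM row «`W_{ℚ(a)}` decomposable ⟺ `ā = a`» ON THE WHOLE ISOGENY CLASS
# (Moonen–Zarhin 1998 §1 Criterion (2), «everything only depends on `X` up to isogeny»; Mumford §19 Cor. 1)

Layer `Literature/AlgebraicGeometry/HodgeTheory`; THEOREMS ONLY — no definition, no named fact, sorry-free (D-0026,
net debt 0). Sequel of the seat's `WeilClassesFieldCommutativeDivisorAlgebra` (§4 there: for `End(A)` COMMUTATIVE and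
every `F = ℚ(φ) ⊂ End⁰(A)`, «`W_F` decomposable ⟺ `φ` Rosati-symmetric; all non-zero Weil classes exceptional ⟺ not»;
§5 there: for a CM-type realisation `(A, ι, θ)` of `(K; Φ)` with `End(A)` commutative and `a ∈ 𝓞_K`,
«`W_{ℚ(a)}` decomposable ⟺ `ā = a`», the row «`Y` of Type 4, `d = 1`, `m = 1`: exceptional precisely when `F ⊄ E₀`»)
and of the isogeny calculus `WeilClassesFieldIsogenyInvariance` / `WeilClassesFieldIsogenyTransportOfStructure`.
Moonen–Zarhin's Criterion (2) is stated for `X` ISOGENOUS to `Y^m`, `Y` simple («Since everything only depends on `X`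
up to isogeny, we may even assume that `X = Y^m`»); THIS file removes the assumption `X = Y` from the two rows the
prequel proved on the carrier: the hypothesis «`End` commutative» is itself an isogeny invariant (§1, Mumford §19
Cor. 1: `End⁰(X)` is an isogeny invariant — here at the integral level, by the quasi-inverse and torsion-freeness), and
the CM row travels along equivariant and bare isogenies out of / into the realisation `A`.

## The print

B. J. J. Moonen, Yu. G. Zarhin, *Weil classes on abelian varieties*, J. reine angew. Math. **496** (1998) =
arXiv:alg-geom/9612017 [MoonenZarhin1998WeilClasses] (held text `paper:arxiv-alg-geom_9612017`): §1 chunk p0002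
L44–L46 «Since everything only depends on `X` up to isogeny, we may even assume that `X = Y^m` for some `m ≥ 1`, where
`Y` is simple. Let `D = End⁰(Y)`, let `E` be the center of `D`, and let `E₀` be the maximal totally real subfield of
`E`»; Criterion (2) (chunk p0003 L46–L58) «Suppose `X` is isogenous to a power `Y^m` of a simple abelian variety `Y` …
this last possibility occurs precisely in the following cases: … `Y` is of Type 4, `d = 1`, `m = 1` and `F ⊄ E₀`, …»
and its proof (chunk p0003 L62–L70: «`G_div(X)` acts as the identity on `W_F` if and only if `F ⊆ B`»). D. Mumford,
*Abelian Varieties* (1970) [MumfordAV1970], §19 Remark p. 169 (quasi-inverse), Thm. 3 p. 176 (`Hom(X, Y)` torsion-free),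
Cor. 1 p. 174 (`End⁰` of isogenous abelian varieties). G. Shimura, *Abelian Varieties with Complex Multiplication and
Modular Functions* (1998) [Shimura1998], §6.2 Thm. 4 (3) (the Rosati involution induces `a ↦ ā` on `K`).

## What is proved

* §1 **`End` COMMUTATIVE IS AN ISOGENY INVARIANT** (integral form): `AbelianVariety.forall_comp_comm_of_isIsogeny` (`f :
  A ⟶ B` an isogeny with quasi-inverse `g`, `End(A)` commutative ⟹ `End(B)` commutative: for `u, v ∈ End(B)` the
  transports `f ≫ u ≫ g`, `f ≫ v ≫ g` commute in `End(A)`, whence `n · (f ≫ (uv − vu) ≫ g) = 0`, `f ≫ (uv − vu) ≫ g = 0`,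
  `n² · (uv − vu) = g ≫ f ≫ (uv − vu) ≫ g ≫ f = 0`, and `End(B)` is torsion-free), `AbelianVariety.forall_comp_comm_of_isIsogeny'`
  (the source inherits it from the target), `AbelianVariety.forall_comp_comm_iff_of_isIsogenous`.
* §2 CRITERION (2) FOR THE ISOGENY CLASS OF AN ABELIAN VARIETY WITH COMMUTATIVE `End` — for `X` isogenous to `A` (either
  direction), `End(A)` commutative, EVERY `F = ℚ(ψ) ⊂ End⁰(X)` (`P(ψ) = 0`, `P` monic irreducible of degree `e`,
  `e · 2m = 2 dim X`) and every polarization class `h` of `X` (rational with a Kähler multiple):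
  `weilClassesField_le_divisorClassesSpan_iff_symm_of_isIsogenous_of_forall_comp_comm` («`W_F(X)` decomposable ⟺ `ψ`
  is `Q_h`-symmetric, `ψ† = ψ`») and `weilClassesField_inf_divisorClassesSpan_eq_bot_iff_not_symm_of_isIsogenous_of_forall_comp_comm`
  («all non-zero Weil classes of `X` exceptional ⟺ `ψ† ≠ ψ`», `m ≠ 0`).
* §3 THE CM ROW ALONG AN EQUIVARIANT ISOGENY — `(A, ι, θ)` a CM-type realisation of `(K; Φ)` (`K` a CM field) with
  `End(A)` commutative, `a ∈ 𝓞_K` with `P(ι a) = 0`, `e · 2m = 2 dim A`; `f : A ⟶ X` an isogeny and `ψ ∈ End(X)` with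
  `ι(a) ≫ f = f ≫ ψ` (e.g. `ψ = ι′(a)` for an `𝓞_K`-structure `ι′` on `X` making `f` a homomorphism of `(A, ι)` onto
  `(X, ι′)`), or `f : X ⟶ A` with `ψ ≫ f = f ≫ ι(a)`:
  **`weilClassesField_le_divisorClassesSpan_iff_conj_eq_of_isCMTypeRealisation_of_isIsogeny`**(') («`W_{ℚ(a)}(X)`
  decomposable ⟺ `ā = a`»), **`weilClassesField_inf_divisorClassesSpan_eq_bot_iff_conj_ne_of_isCMTypeRealisation_of_isIsogeny`**(')
  («all non-zero classes of `W_{ℚ(a)}(X)` exceptional ⟺ `ā ≠ a`», `m ≠ 0`),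
  `weilClassesField_le_algebraicClasses_of_conj_eq_of_isCMTypeRealisation_of_isIsogeny`(') (`ā = a` ⟹ algebraic).
* §4 THE CM ROW ALONG A BARE ISOGENY — `X` merely isogenous to `A` (`f : X ⟶ A` an isogeny with quasi-inverse `g`,
  `g ≫ f = [n]_A`): the TRANSPORTED generator `f ≫ ι(a) ≫ g ∈ End(X)` of `ℚ(a) ⊂ End⁰(X) = End⁰(A)` with the rescaled
  polynomial `P_n = P.scaleRoots n`: `weilClassesField_transport_le_divisorClassesSpan_iff_conj_eq_of_isCMTypeRealisation`,
  `weilClassesField_transport_inf_divisorClassesSpan_eq_bot_iff_conj_ne_of_isCMTypeRealisation`,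
  `weilClassesField_transport_le_algebraicClasses_of_conj_eq_of_isCMTypeRealisation`; packaged over
  `AbelianVariety.IsIsogenous X A` / `IsIsogenous A X`: **`exists_transport_iff_conj_eq_of_isCMTypeRealisation_of_isIsogenous`**(').

Scope (honest column). As in the prequel: carrier statements; «`End(A)` commutative» for a CM-type realisation by the
field `K` is the print's «`X` simple, `End⁰(X) = K`» (my gloss, not used); the identification with the print's row (Table
1) is quoted, not formalised. §4's transported generator is the integral element `n·(f ι(a) f⁻¹)`; no `𝓞_K`-structure
on `X` is constructed (a bare isogeny transports `K ⊂ End⁰` but not the order). Nothing here proves HC for any `X`.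

## References

* [MoonenZarhin1998WeilClasses] B. J. J. Moonen, Yu. G. Zarhin, J. reine angew. Math. 496 (1998) =
  arXiv:alg-geom/9612017, §1 (chunk p0002 L44–L46), Criterion (2) and its proof (chunk p0003 L46–L70).
* [MumfordAV1970] D. Mumford, Abelian Varieties (1970), §19 Remark p. 169, Cor. 1 p. 174, Thm. 3 p. 176.
* [Shimura1998] G. Shimura, Abelian Varieties with Complex Multiplication and Modular Functions (1998), §6.2 Thm. 4 (3);
  §8.5 proof of Prop. 31 (type `(K; Φ)` along an equivariant isogeny).
* [vanGeemen1994HodgeAV] B. van Geemen, LNM 1594 (1994), 3.6–3.7 (p. 236) and proof of Lemma 5.2 (held p. 7 L41–L42).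
-/

noncomputable section

open CategoryTheory Polynomial Module NumberField

namespace Literature.AlgebraicGeometry.Motives.AbelianVariety

/-! ### §1 `End` commutative is an isogeny invariant (Mumford §19 Cor. 1, integral form) -/

section EndComm

variable {A B : AbelianVariety ℂ}

/-- **`End(A)` commutative ⟹ `End(B)` commutative along an isogeny `f : A ⟶ B`.** With a quasi-inverse `g`
(`f ≫ g = [n]_A`, `g ≫ f = [n]_B`, `0 < n`): for `u, v ∈ End(B)` the elements `f ≫ u ≫ g`, `f ≫ v ≫ g ∈ End(A)`
commute, which reads `n · (f ≫ (u ≫ v − v ≫ u) ≫ g) = 0`; `Hom(A, B)` is torsion-free (Mumford §19 Thm. 3), so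
`f ≫ (u ≫ v − v ≫ u) ≫ g = 0`, hence `n² · (u ≫ v − v ≫ u) = g ≫ f ≫ (u ≫ v − v ≫ u) ≫ g ≫ f = 0` and `u ≫ v = v ≫ u`
(isogenies «preserve `End_ℚ`»). [cite: MumfordAV1970, §19 Remark p. 169, Cor. 1 p. 174 and Thm. 3 p. 176]
[cite: vanGeemen1994HodgeAV, proof of Lemma 5.2 (held p. 7 L41–L42)] -/
theorem forall_comp_comm_of_isIsogeny {f : A ⟶ B} (hf : IsIsogeny f) (hE : ∀ u v : A ⟶ A, u ≫ v = v ≫ u) :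
    ∀ u v : B ⟶ B, u ≫ v = v ≫ u := by
  obtain ⟨g, n, hn, hfg, hgf⟩ := IsIsogeny.exists_nsmul_inverse_holds hf
  have hgf' : ∀ {Z : AbelianVariety ℂ} (w : B ⟶ Z), g ≫ f ≫ w = n • w := fun w => by
    rw [← Category.assoc, hgf, Preadditive.nsmul_comp, Category.id_comp]
  intro u v
  -- the transports `f ≫ u ≫ g`, `f ≫ v ≫ g` commute in `End(A)`
  have h1 := hE (f ≫ u ≫ g) (f ≫ v ≫ g)
  simp only [Category.assoc] at h1
  rw [hgf', hgf', Preadditive.comp_nsmul, Preadditive.comp_nsmul, Preadditive.comp_nsmul,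
    Preadditive.comp_nsmul] at h1
  -- `h1 : n • (f ≫ u ≫ v ≫ g) = n • (f ≫ v ≫ u ≫ g)`
  have h2 : f ≫ (u ≫ v - v ≫ u) ≫ g = 0 := by
    refine hom_eq_zero_of_nsmul_eq_zero hn.ne' ?_
    rw [Preadditive.sub_comp, Preadditive.comp_sub, smul_sub, Category.assoc, Category.assoc, h1, sub_self]
  -- sandwich with `g` and `f`: `n² · (uv − vu) = 0`
  have h3 : g ≫ (f ≫ (u ≫ v - v ≫ u) ≫ g) ≫ f = 0 := by
    rw [h2, Limits.zero_comp, Limits.comp_zero]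
  rw [Category.assoc, Category.assoc, hgf', hgf, Preadditive.comp_nsmul, Category.comp_id] at h3
  -- `h3 : n • n • (u ≫ v - v ≫ u) = 0`
  exact sub_eq_zero.1 (hom_eq_zero_of_nsmul_eq_zero hn.ne' (hom_eq_zero_of_nsmul_eq_zero hn.ne' h3))

/-- **`End(B)` commutative ⟹ `End(A)` commutative along an isogeny `f : A ⟶ B`** (apply the previous theorem to a
quasi-inverse `g : B ⟶ A`, itself an isogeny). [cite: MumfordAV1970, §19 Remark p. 169, Cor. 1 p. 174 and Thm. 3 p. 176] -/
theorem forall_comp_comm_of_isIsogeny' {f : A ⟶ B} (hf : IsIsogeny f) (hE : ∀ u v : B ⟶ B, u ≫ v = v ≫ u) :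
    ∀ u v : A ⟶ A, u ≫ v = v ≫ u := by
  obtain ⟨g, n, hn, hfg, hgf⟩ := IsIsogeny.exists_nsmul_inverse_holds hf
  have hg : IsIsogeny g :=
    isIsogeny_of_comp_eq_of_comp_eq (isIsogeny_nsmul_id_of_cast_ne_zero _ _ (Nat.cast_ne_zero.2 hn.ne'))
      (isIsogeny_nsmul_id_of_cast_ne_zero _ _ (Nat.cast_ne_zero.2 hn.ne')) hfg hgf
  exact forall_comp_comm_of_isIsogeny hg hE

/-- **`End` commutative is an invariant of the isogeny class** (`AbelianVariety.IsIsogenous A B`).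
[cite: MumfordAV1970, §19 Cor. 1 p. 174] [cite: MoonenZarhin1998WeilClasses, §1 (chunk p0002 L44–L46)] -/
theorem forall_comp_comm_iff_of_isIsogenous (h : IsIsogenous A B) :
    (∀ u v : A ⟶ A, u ≫ v = v ≫ u) ↔ ∀ u v : B ⟶ B, u ≫ v = v ≫ u := by
  obtain ⟨f, hf⟩ := h
  exact ⟨forall_comp_comm_of_isIsogeny hf, forall_comp_comm_of_isIsogeny' hf⟩

end EndComm

end Literature.AlgebraicGeometry.Motives.AbelianVariety

namespace Literature.AlgebraicGeometry.HodgeTheory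

open Literature.AlgebraicGeometry.Motives
open Literature.AlgebraicGeometry.VanGeemen1994 (hodgeClassSpan pullbackOne)
open Literature.AlgebraicTopology.SingularHomology
open Literature.Barriers.HodgeConjecture (divisorClassesSpan)

/-! ### §2 Criterion (2) for commutative `End`, on the isogeny class -/

section CommutativeEnd

variable {A X : AbelianVariety ℂ} {h : complexBetti X.X 2} {ψ : X ⟶ X} {P : Polynomial ℤ} {e m : ℕ} {t : ℝ}

/-- **`X` isogenous to an `A` with commutative `End(A)` ⟹ for EVERY `F = ℚ(ψ) ⊂ End⁰(X)`: `W_F(X) ⊗ ℂ ≤ 𝒟ᵐ(X) ⊗ ℂ`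
iff `ψ^*` is `Q_h`-symmetric** (`ψ† = ψ`; `h` any rational class with a Kähler multiple `t • h`, `P(ψ) = 0`, `P` monic
irreducible of degree `e`, `e · 2m = 2 dim X`) — the prequel's §4 with its commutativity hypothesis discharged on `A`
(§1). [cite: MoonenZarhin1998WeilClasses, §1 Criterion (2) and its proof (chunk p0003 L46–L70), chunk p0002 L44–L46]
[cite: MumfordAV1970, §19 Cor. 1 p. 174] -/
theorem weilClassesField_le_divisorClassesSpan_iff_symm_of_isIsogenous_of_forall_comp_comm
    (hXA : AbelianVariety.IsIsogenous X A) (hE : ∀ u v : A ⟶ A, u ≫ v = v ≫ u) (hX : 0 < X.dim)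
    (hQ : IsRationalClass h) (ht : t ≠ 0) (hK : IsKaehlerClass X.dim X.X ((t : ℂ) • h))
    (hPm : P.Monic) (hPe : P.natDegree = e) (hPirr : Irreducible (P.map (Int.castRingHom ℚ)))
    (hψ : Polynomial.eval₂ (Int.castRingHom (CategoryTheory.End X)) (ψ : CategoryTheory.End X) P = 0)
    (her : e * (2 * m) = 2 * X.dim) :
    weilClassesField X ψ P (2 * m) ≤ divisorClassesSpan X.X X.dim m ↔
      ∀ x y : complexBetti X.X 1, polarizationPairingOne X.X h (X.dim - 1) (pullbackOne X ψ x) y =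
        polarizationPairingOne X.X h (X.dim - 1) x (pullbackOne X ψ y) :=
  weilClassesField_le_divisorClassesSpan_iff_symm_of_forall_comp_comm hX
    ((AbelianVariety.forall_comp_comm_iff_of_isIsogenous hXA).2 hE) hQ ht hK hPm hPe hPirr hψ her

/-- **… and all non-zero Weil classes of `F = ℚ(ψ)` on `X` are exceptional iff `ψ† ≠ ψ`** (`m ≠ 0`).
[cite: MoonenZarhin1998WeilClasses, §1 Criterion (2) and its proof (chunk p0003 L46–L70), chunk p0002 L44–L46]
[cite: MumfordAV1970, §19 Cor. 1 p. 174] -/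
theorem weilClassesField_inf_divisorClassesSpan_eq_bot_iff_not_symm_of_isIsogenous_of_forall_comp_comm
    (hXA : AbelianVariety.IsIsogenous X A) (hE : ∀ u v : A ⟶ A, u ≫ v = v ≫ u) (hX : 0 < X.dim)
    (hQ : IsRationalClass h) (ht : t ≠ 0) (hK : IsKaehlerClass X.dim X.X ((t : ℂ) • h))
    (hPm : P.Monic) (hPe : P.natDegree = e) (hPirr : Irreducible (P.map (Int.castRingHom ℚ)))
    (hψ : Polynomial.eval₂ (Int.castRingHom (CategoryTheory.End X)) (ψ : CategoryTheory.End X) P = 0)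
    (her : e * (2 * m) = 2 * X.dim) (hm : m ≠ 0) :
    weilClassesField X ψ P (2 * m) ⊓ divisorClassesSpan X.X X.dim m = ⊥ ↔
      ¬ ∀ x y : complexBetti X.X 1, polarizationPairingOne X.X h (X.dim - 1) (pullbackOne X ψ x) y =
        polarizationPairingOne X.X h (X.dim - 1) x (pullbackOne X ψ y) :=
  weilClassesField_inf_divisorClassesSpan_eq_bot_iff_not_symm_of_forall_comp_comm hX
    ((AbelianVariety.forall_comp_comm_iff_of_isIsogenous hXA).2 hE) hQ ht hK hPm hPe hPirr hψ her hm

end CommutativeEnd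

/-! ### §3 The CM row along an equivariant isogeny -/

section CM

open Literature.AlgebraicGeometry.ComplexMultiplication

variable {K : Type} [Field K] [NumberField K] [IsCMField K] {Φ : CMType K} {A X : AbelianVariety ℂ}
  {ιA : 𝓞 K →+* CategoryTheory.End A} {θ : K →+* Module.End ℂ (complexBetti A.X 1)} {ψ : X ⟶ X}
  {P : Polynomial ℤ} {e m : ℕ}

/-- **THE CM ROW ON THE TARGET OF AN EQUIVARIANT ISOGENY**: `(A, ι, θ)` a realisation of the CM type `(K; Φ)` with
`End(A)` commutative, `a ∈ 𝓞_K` with `P(ι a) = 0` (`P` monic irreducible of degree `e`, `e · 2m = 2 dim A`),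
`f : A ⟶ X` an isogeny and `ψ ∈ End(X)` with `ι(a) ≫ f = f ≫ ψ` (e.g. `ψ = ι′(a)` for `f` a homomorphism of `(A, ι)`
onto `(X, ι′)`). Then `W_{ℚ(a)}(X) ⊗ ℂ = weilClassesField X ψ P (2m) ≤ 𝒟ᵐ(X) ⊗ ℂ ⟺ ā = a` (the prequel's CM row on
`A`, carried by `WeilClassesFieldIsogenyInvariance`). [cite: MoonenZarhin1998WeilClasses, §1 Criterion (2) («Y is of
Type 4, d = 1, m = 1 and F ⊄ E₀»; chunk p0003 L46–L70) and chunk p0002 L44–L46] [cite: Shimura1998, §6.2 Theorem 4 (3);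
§8.5 proof of Prop. 31] -/
theorem weilClassesField_le_divisorClassesSpan_iff_conj_eq_of_isCMTypeRealisation_of_isIsogeny
    (hR : IsCMTypeRealisation Φ A ιA θ) (hE : ∀ u v : A ⟶ A, u ≫ v = v ≫ u) {a : 𝓞 K} {f : A ⟶ X}
    (hf : AbelianVariety.IsIsogeny f) (hcomm : f ≫ ψ = (ιA a : A ⟶ A) ≫ f)
    (hPm : P.Monic) (hPe : P.natDegree = e) (hPirr : Irreducible (P.map (Int.castRingHom ℚ)))
    (hφ : Polynomial.eval₂ (Int.castRingHom (CategoryTheory.End A)) (ιA a) P = 0) (her : e * (2 * m) = 2 * A.dim) :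
    weilClassesField X ψ P (2 * m) ≤ divisorClassesSpan X.X X.dim m ↔ IsCMField.complexConj K (a : K) = a :=
  (weilClassesField_le_divisorClassesSpan_iff_of_isIsogeny_of_comm hf hcomm P m).symm.trans
    (weilClassesField_le_divisorClassesSpan_iff_conj_eq_of_isCMTypeRealisation hR hE hPm hPe hPirr hφ her)

/-- **THE CM ROW ON THE SOURCE OF AN EQUIVARIANT ISOGENY** `f : X ⟶ A` with `ψ ≫ f = f ≫ ι(a)`:
`weilClassesField X ψ P (2m) ≤ 𝒟ᵐ(X) ⊗ ℂ ⟺ ā = a`. [cite: MoonenZarhin1998WeilClasses, §1 Criterion (2) (chunk p0003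
L46–L70) and chunk p0002 L44–L46] [cite: Shimura1998, §6.2 Theorem 4 (3)] -/
theorem weilClassesField_le_divisorClassesSpan_iff_conj_eq_of_isCMTypeRealisation_of_isIsogeny'
    (hR : IsCMTypeRealisation Φ A ιA θ) (hE : ∀ u v : A ⟶ A, u ≫ v = v ≫ u) {a : 𝓞 K} {f : X ⟶ A}
    (hf : AbelianVariety.IsIsogeny f) (hcomm : f ≫ (ιA a : A ⟶ A) = ψ ≫ f)
    (hPm : P.Monic) (hPe : P.natDegree = e) (hPirr : Irreducible (P.map (Int.castRingHom ℚ)))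
    (hφ : Polynomial.eval₂ (Int.castRingHom (CategoryTheory.End A)) (ιA a) P = 0) (her : e * (2 * m) = 2 * A.dim) :
    weilClassesField X ψ P (2 * m) ≤ divisorClassesSpan X.X X.dim m ↔ IsCMField.complexConj K (a : K) = a :=
  (weilClassesField_le_divisorClassesSpan_iff_of_isIsogeny_of_comm hf hcomm P m).trans
    (weilClassesField_le_divisorClassesSpan_iff_conj_eq_of_isCMTypeRealisation hR hE hPm hPe hPirr hφ her)

/-- **«All non-zero classes of `W_{ℚ(a)}(X)` are exceptional ⟺ `ā ≠ a`» on the target of an equivariant isogeny**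
(`m ≠ 0`). [cite: MoonenZarhin1998WeilClasses, §1 Criterion (2) («F ⊄ E₀»; chunk p0003 L46–L70) and chunk p0002
L44–L46] [cite: Shimura1998, §6.2 Theorem 4 (3)] -/
theorem weilClassesField_inf_divisorClassesSpan_eq_bot_iff_conj_ne_of_isCMTypeRealisation_of_isIsogeny
    (hR : IsCMTypeRealisation Φ A ιA θ) (hE : ∀ u v : A ⟶ A, u ≫ v = v ≫ u) {a : 𝓞 K} {f : A ⟶ X}
    (hf : AbelianVariety.IsIsogeny f) (hcomm : f ≫ ψ = (ιA a : A ⟶ A) ≫ f)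
    (hPm : P.Monic) (hPe : P.natDegree = e) (hPirr : Irreducible (P.map (Int.castRingHom ℚ)))
    (hφ : Polynomial.eval₂ (Int.castRingHom (CategoryTheory.End A)) (ιA a) P = 0) (her : e * (2 * m) = 2 * A.dim)
    (hm : m ≠ 0) :
    weilClassesField X ψ P (2 * m) ⊓ divisorClassesSpan X.X X.dim m = ⊥ ↔ IsCMField.complexConj K (a : K) ≠ a :=
  (weilClassesField_inf_divisorClassesSpan_eq_bot_iff_of_isIsogeny_of_comm hf hcomm P m).symm.trans
    (weilClassesField_inf_divisorClassesSpan_eq_bot_iff_conj_ne_of_isCMTypeRealisation hR hE hPm hPe hPirr hφ her hm)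

/-- **«All non-zero classes of `W_{ℚ(a)}(X)` are exceptional ⟺ `ā ≠ a`» on the source of an equivariant isogeny.**
[cite: MoonenZarhin1998WeilClasses, §1 Criterion (2) (chunk p0003 L46–L70) and chunk p0002 L44–L46]
[cite: Shimura1998, §6.2 Theorem 4 (3)] -/
theorem weilClassesField_inf_divisorClassesSpan_eq_bot_iff_conj_ne_of_isCMTypeRealisation_of_isIsogeny'
    (hR : IsCMTypeRealisation Φ A ιA θ) (hE : ∀ u v : A ⟶ A, u ≫ v = v ≫ u) {a : 𝓞 K} {f : X ⟶ A}
    (hf : AbelianVariety.IsIsogeny f) (hcomm : f ≫ (ιA a : A ⟶ A) = ψ ≫ f)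
    (hPm : P.Monic) (hPe : P.natDegree = e) (hPirr : Irreducible (P.map (Int.castRingHom ℚ)))
    (hφ : Polynomial.eval₂ (Int.castRingHom (CategoryTheory.End A)) (ιA a) P = 0) (her : e * (2 * m) = 2 * A.dim)
    (hm : m ≠ 0) :
    weilClassesField X ψ P (2 * m) ⊓ divisorClassesSpan X.X X.dim m = ⊥ ↔ IsCMField.complexConj K (a : K) ≠ a :=
  (weilClassesField_inf_divisorClassesSpan_eq_bot_iff_of_isIsogeny_of_comm hf hcomm P m).trans
    (weilClassesField_inf_divisorClassesSpan_eq_bot_iff_conj_ne_of_isCMTypeRealisation hR hE hPm hPe hPirr hφ her hm)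

/-- **`ā = a` ⟹ the Weil classes of `ℚ(a)` on the target `X` are ALGEBRAIC** (decomposable, then Lefschetz `(1,1)`;
equivariant isogeny out of `A`). [cite: MoonenZarhin1998WeilClasses, Introduction (chunk p0001 L10–L18) and §1 Criterion
(2) (chunk p0003 L46–L70)] [cite: vanGeemen1994HodgeAV, 3.6–3.7 (p. 236)] -/
theorem weilClassesField_le_algebraicClasses_of_conj_eq_of_isCMTypeRealisation_of_isIsogeny
    (hR : IsCMTypeRealisation Φ A ιA θ) (hE : ∀ u v : A ⟶ A, u ≫ v = v ≫ u) {a : 𝓞 K} {f : A ⟶ X}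
    (hf : AbelianVariety.IsIsogeny f) (hcomm : f ≫ ψ = (ιA a : A ⟶ A) ≫ f)
    (hPm : P.Monic) (hPe : P.natDegree = e) (hPirr : Irreducible (P.map (Int.castRingHom ℚ)))
    (hφ : Polynomial.eval₂ (Int.castRingHom (CategoryTheory.End A)) (ιA a) P = 0) (her : e * (2 * m) = 2 * A.dim)
    (ha : IsCMField.complexConj K (a : K) = a) :
    weilClassesField X ψ P (2 * m) ≤ algebraicClasses X.X m :=
  (weilClassesField_le_algebraicClasses_iff_of_isIsogeny_of_comm hf hcomm P m).1
    (weilClassesField_le_algebraicClasses_of_conj_eq_of_isCMTypeRealisation hR hE hPm hPe hPirr hφ her ha)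

/-- **`ā = a` ⟹ the Weil classes of `ℚ(a)` on the source `X` are ALGEBRAIC** (equivariant isogeny into `A`).
[cite: MoonenZarhin1998WeilClasses, §1 Criterion (2) (chunk p0003 L46–L70)] [cite: vanGeemen1994HodgeAV, 3.6–3.7 (p. 236)] -/
theorem weilClassesField_le_algebraicClasses_of_conj_eq_of_isCMTypeRealisation_of_isIsogeny'
    (hR : IsCMTypeRealisation Φ A ιA θ) (hE : ∀ u v : A ⟶ A, u ≫ v = v ≫ u) {a : 𝓞 K} {f : X ⟶ A}
    (hf : AbelianVariety.IsIsogeny f) (hcomm : f ≫ (ιA a : A ⟶ A) = ψ ≫ f)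
    (hPm : P.Monic) (hPe : P.natDegree = e) (hPirr : Irreducible (P.map (Int.castRingHom ℚ)))
    (hφ : Polynomial.eval₂ (Int.castRingHom (CategoryTheory.End A)) (ιA a) P = 0) (her : e * (2 * m) = 2 * A.dim)
    (ha : IsCMField.complexConj K (a : K) = a) :
    weilClassesField X ψ P (2 * m) ≤ algebraicClasses X.X m :=
  (weilClassesField_le_algebraicClasses_iff_of_isIsogeny_of_comm hf hcomm P m).2
    (weilClassesField_le_algebraicClasses_of_conj_eq_of_isCMTypeRealisation hR hE hPm hPe hPirr hφ her ha)

/-! ### §4 The CM row along a bare isogeny: the transported generator `f ≫ ι(a) ≫ g` of `ℚ(a) ⊂ End⁰(X)` -/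

/-- **THE CM ROW FOR THE TRANSPORTED STRUCTURE.** `(A, ι, θ)` a realisation of `(K; Φ)` with `End(A)` commutative,
`a ∈ 𝓞_K`, `P(ι a) = 0` (`P` monic irreducible of degree `e`, `e · 2m = 2 dim A`); `f : X ⟶ A` an isogeny with `g ≫ f =
[n]_A`, `0 < n`. Then for the transported generator `f ≫ ι(a) ≫ g ∈ End(X)` (annihilated by `P_n = P.scaleRoots n`):
`weilClassesField X (f ≫ ι a ≫ g) P_n (2m) ≤ 𝒟ᵐ(X) ⊗ ℂ ⟺ ā = a`. [cite: MoonenZarhin1998WeilClasses, §1 Criterion (2)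
(chunk p0003 L46–L70) and chunk p0002 L44–L46 («everything only depends on X up to isogeny»)] [cite: MumfordAV1970, §19
Remark p. 169] [cite: Shimura1998, §6.2 Theorem 4 (3)] -/
theorem weilClassesField_transport_le_divisorClassesSpan_iff_conj_eq_of_isCMTypeRealisation
    (hR : IsCMTypeRealisation Φ A ιA θ) (hE : ∀ u v : A ⟶ A, u ≫ v = v ≫ u) {a : 𝓞 K} {f : X ⟶ A} {g : A ⟶ X}
    {n : ℕ} (hf : AbelianVariety.IsIsogeny f) (hgf : g ≫ f = n • 𝟙 A) (hn : 0 < n)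
    (hPm : P.Monic) (hPe : P.natDegree = e) (hPirr : Irreducible (P.map (Int.castRingHom ℚ)))
    (hφ : Polynomial.eval₂ (Int.castRingHom (CategoryTheory.End A)) (ιA a) P = 0) (her : e * (2 * m) = 2 * A.dim) :
    weilClassesField X (f ≫ (ιA a : A ⟶ A) ≫ g) (P.scaleRoots (n : ℤ)) (2 * m) ≤ divisorClassesSpan X.X X.dim m ↔
      IsCMField.complexConj K (a : K) = a :=
  (weilClassesField_transport_le_divisorClassesSpan_iff hf hgf hn.ne' hPirr hφ m).trans
    (weilClassesField_le_divisorClassesSpan_iff_conj_eq_of_isCMTypeRealisation hR hE hPm hPe hPirr hφ her)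

/-- **… `weilClassesField X (f ≫ ι a ≫ g) P_n (2m) ⊓ 𝒟ᵐ(X) ⊗ ℂ = ⊥ ⟺ ā ≠ a`** (`m ≠ 0`): all non-zero Weil classes of
the transported `ℚ(a)` are exceptional exactly when `a ∉ K⁺`. [cite: MoonenZarhin1998WeilClasses, §1 Criterion (2)
(«F ⊄ E₀»; chunk p0003 L46–L70) and chunk p0002 L44–L46] [cite: MumfordAV1970, §19 Remark p. 169] -/
theorem weilClassesField_transport_inf_divisorClassesSpan_eq_bot_iff_conj_ne_of_isCMTypeRealisation
    (hR : IsCMTypeRealisation Φ A ιA θ) (hE : ∀ u v : A ⟶ A, u ≫ v = v ≫ u) {a : 𝓞 K} {f : X ⟶ A} {g : A ⟶ X}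
    {n : ℕ} (hf : AbelianVariety.IsIsogeny f) (hgf : g ≫ f = n • 𝟙 A) (hn : 0 < n)
    (hPm : P.Monic) (hPe : P.natDegree = e) (hPirr : Irreducible (P.map (Int.castRingHom ℚ)))
    (hφ : Polynomial.eval₂ (Int.castRingHom (CategoryTheory.End A)) (ιA a) P = 0) (her : e * (2 * m) = 2 * A.dim)
    (hm : m ≠ 0) :
    weilClassesField X (f ≫ (ιA a : A ⟶ A) ≫ g) (P.scaleRoots (n : ℤ)) (2 * m) ⊓ divisorClassesSpan X.X X.dim m = ⊥ ↔
      IsCMField.complexConj K (a : K) ≠ a :=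
  (weilClassesField_transport_inf_divisorClassesSpan_eq_bot_iff hf hgf hn.ne' hPirr hφ m).trans
    (weilClassesField_inf_divisorClassesSpan_eq_bot_iff_conj_ne_of_isCMTypeRealisation hR hE hPm hPe hPirr hφ her hm)

/-- **`ā = a` ⟹ the Weil classes of the transported `ℚ(a)` on `X` are ALGEBRAIC.** [cite: MoonenZarhin1998WeilClasses,
§1 Criterion (2) (chunk p0003 L46–L70)] [cite: vanGeemen1994HodgeAV, 3.6–3.7 (p. 236)] -/
theorem weilClassesField_transport_le_algebraicClasses_of_conj_eq_of_isCMTypeRealisation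
    (hR : IsCMTypeRealisation Φ A ιA θ) (hE : ∀ u v : A ⟶ A, u ≫ v = v ≫ u) {a : 𝓞 K} {f : X ⟶ A} {g : A ⟶ X}
    {n : ℕ} (hf : AbelianVariety.IsIsogeny f) (hgf : g ≫ f = n • 𝟙 A) (hn : 0 < n)
    (hPm : P.Monic) (hPe : P.natDegree = e) (hPirr : Irreducible (P.map (Int.castRingHom ℚ)))
    (hφ : Polynomial.eval₂ (Int.castRingHom (CategoryTheory.End A)) (ιA a) P = 0) (her : e * (2 * m) = 2 * A.dim)
    (ha : IsCMField.complexConj K (a : K) = a) :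
    weilClassesField X (f ≫ (ιA a : A ⟶ A) ≫ g) (P.scaleRoots (n : ℤ)) (2 * m) ≤ algebraicClasses X.X m :=
  (weilClassesField_transport_le_algebraicClasses_iff hf hgf hn.ne' hPirr hφ m).2
    (weilClassesField_le_algebraicClasses_of_conj_eq_of_isCMTypeRealisation hR hE hPm hPe hPirr hφ her ha)

/-- **THE CM ROW ON THE WHOLE ISOGENY CLASS, PACKAGED.** For a realisation `(A, ι, θ)` of `(K; Φ)` with `End(A)`
commutative, `a ∈ 𝓞_K` with `P(ι a) = 0` (`P` monic irreducible of degree `e`, `e · 2m = 2 dim A`) and EVERY `X`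
isogenous to `A` (`AbelianVariety.IsIsogenous X A`): `End(X)` is commutative, `dim X = dim A`, and there are `ψ ∈
End(X)`, `0 < n` and a monic `P' ∈ ℤ[T]` of degree `e`, irreducible over `ℚ`, with `P'(ψ) = 0` (`ψ = f ι(a) g`,
`P' = P_n`: `ℚ(ψ) = ℚ(a) ⊂ End⁰(X) = End⁰(A)`) such that `W(X; ψ, P') ⊗ ℂ ≤ 𝒟ᵐ(X) ⊗ ℂ ⟺ ā = a`, for `m ≠ 0`
`W(X; ψ, P') ⊗ ℂ ⊓ 𝒟ᵐ(X) ⊗ ℂ = ⊥ ⟺ ā ≠ a`, and `ā = a ⟹ W(X; ψ, P') ⊗ ℂ ≤ Algᵐ(X)`.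
[cite: MoonenZarhin1998WeilClasses, §1 Criterion (2) (chunk p0003 L46–L70) and chunk p0002 L44–L46]
[cite: MumfordAV1970, §19 Remark p. 169 and Cor. 1 p. 174] [cite: Shimura1998, §6.2 Theorem 4 (3)] -/
theorem exists_transport_iff_conj_eq_of_isCMTypeRealisation_of_isIsogenous
    (hR : IsCMTypeRealisation Φ A ιA θ) (hE : ∀ u v : A ⟶ A, u ≫ v = v ≫ u) (hXA : AbelianVariety.IsIsogenous X A)
    {a : 𝓞 K} (hPm : P.Monic) (hPe : P.natDegree = e) (hPirr : Irreducible (P.map (Int.castRingHom ℚ)))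
    (hφ : Polynomial.eval₂ (Int.castRingHom (CategoryTheory.End A)) (ιA a) P = 0) (her : e * (2 * m) = 2 * A.dim) :
    (∀ u v : X ⟶ X, u ≫ v = v ≫ u) ∧ X.dim = A.dim ∧
      ∃ (ψ : X ⟶ X) (n : ℕ) (P' : Polynomial ℤ), 0 < n ∧ P'.Monic ∧ P'.natDegree = e ∧
        Irreducible (P'.map (Int.castRingHom ℚ)) ∧
        Polynomial.eval₂ (Int.castRingHom (CategoryTheory.End X)) (End.of ψ) P' = 0 ∧
        (weilClassesField X ψ P' (2 * m) ≤ divisorClassesSpan X.X X.dim m ↔ IsCMField.complexConj K (a : K) = a) ∧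
        (m ≠ 0 → (weilClassesField X ψ P' (2 * m) ⊓ divisorClassesSpan X.X X.dim m = ⊥ ↔
          IsCMField.complexConj K (a : K) ≠ a)) ∧
        (IsCMField.complexConj K (a : K) = a → weilClassesField X ψ P' (2 * m) ≤ algebraicClasses X.X m) := by
  obtain ⟨f, hf⟩ := hXA
  obtain ⟨g, n, hn, hfg, hgf⟩ := AbelianVariety.IsIsogeny.exists_nsmul_inverse_holds hf
  refine ⟨(AbelianVariety.forall_comp_comm_iff_of_isIsogenous ⟨f, hf⟩).2 hE, AbelianVariety.dim_eq_of_isIsogeny hf,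
    f ≫ (ιA a : A ⟶ A) ≫ g, n, P.scaleRoots (n : ℤ), hn, (Polynomial.monic_scaleRoots_iff _).2 hPm,
    (Polynomial.natDegree_scaleRoots P (n : ℤ)).trans hPe, irreducible_map_scaleRoots_natCast hPirr hn.ne',
    eval₂_transport_scaleRoots_eq_zero hgf hfg hn.ne' hφ,
    weilClassesField_transport_le_divisorClassesSpan_iff_conj_eq_of_isCMTypeRealisation hR hE hf hgf hn hPm hPe hPirr hφ
      her, fun hm => ?_, fun ha => ?_⟩
  · exact weilClassesField_transport_inf_divisorClassesSpan_eq_bot_iff_conj_ne_of_isCMTypeRealisation hR hE hf hgf hn hPm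
      hPe hPirr hφ her hm
  · exact weilClassesField_transport_le_algebraicClasses_of_conj_eq_of_isCMTypeRealisation hR hE hf hgf hn hPm hPe hPirr
      hφ her ha

/-- The same for `AbelianVariety.IsIsogenous A X` (isogeny is symmetric, `IsIsogenous.symm'`).
[cite: MoonenZarhin1998WeilClasses, §1 Criterion (2) (chunk p0003 L46–L70) and chunk p0002 L44–L46]
[cite: MumfordAV1970, §19 Remark p. 169] -/
theorem exists_transport_iff_conj_eq_of_isCMTypeRealisation_of_isIsogenous'
    (hR : IsCMTypeRealisation Φ A ιA θ) (hE : ∀ u v : A ⟶ A, u ≫ v = v ≫ u) (hAX : AbelianVariety.IsIsogenous A X)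
    {a : 𝓞 K} (hPm : P.Monic) (hPe : P.natDegree = e) (hPirr : Irreducible (P.map (Int.castRingHom ℚ)))
    (hφ : Polynomial.eval₂ (Int.castRingHom (CategoryTheory.End A)) (ιA a) P = 0) (her : e * (2 * m) = 2 * A.dim) :
    (∀ u v : X ⟶ X, u ≫ v = v ≫ u) ∧ X.dim = A.dim ∧
      ∃ (ψ : X ⟶ X) (n : ℕ) (P' : Polynomial ℤ), 0 < n ∧ P'.Monic ∧ P'.natDegree = e ∧
        Irreducible (P'.map (Int.castRingHom ℚ)) ∧
        Polynomial.eval₂ (Int.castRingHom (CategoryTheory.End X)) (End.of ψ) P' = 0 ∧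
        (weilClassesField X ψ P' (2 * m) ≤ divisorClassesSpan X.X X.dim m ↔ IsCMField.complexConj K (a : K) = a) ∧
        (m ≠ 0 → (weilClassesField X ψ P' (2 * m) ⊓ divisorClassesSpan X.X X.dim m = ⊥ ↔
          IsCMField.complexConj K (a : K) ≠ a)) ∧
        (IsCMField.complexConj K (a : K) = a → weilClassesField X ψ P' (2 * m) ≤ algebraicClasses X.X m) :=
  exists_transport_iff_conj_eq_of_isCMTypeRealisation_of_isIsogenous hR hE hAX.symm' hPm hPe hPirr hφ her

end CM

end Literature.AlgebraicGeometry.HodgeTheory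

end
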